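import Summits.QuantumFields.YangMills.Theorems.VirialFluxGapCentralFieldSlotDerivative
import HarnessLib

/-!
# Route `VirialFluxGap` (YangMills): the explicit central field along the own frame curves of a PLAIN variable (neither wrap-block nor seam nor tree) —
# the radial profile: derivatives of its three half-Pauli coordinates and their exact trace `3·Re q` (central chart C1 of ⟨stmt-QuantumFields-24141⟩; free-hands helper)

Width seat `ym-line-sfw-p2-w3` g59 (cell ym-idea-1, free hands), `--supports stmt-QuantumFields-24141`.

At a variable `(i,e)` of `X_fix` that is not on a wrap layer (`e.1 e.2 ≠ −1`) and not on the slice-`0` comb tree, the explicit central field (✓`centralDir`) is the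
plain radial profile `quatMatrix(0, Im q)`; along its own frame curves the three half-Pauli coordinates have derivatives whose sum is `3·Re(su2Quat P_{i,e}) ≤ 3`
(w3 g58's ✓`slice_profile_div` in the `pauliCoord ∕ stdFrame` letters of the central coefficient family).
* `centralDir_inl_plain`, `centralCoord_plain_eq`, ★ `hasDerivAt_centralCoord_plain`, ★★ `centralCoord_plain_trace` (`V₀ + V₁ + V₂ = 3Re q`),
  ★★ `centralDiv_plain_eq` (frame form under differentiability), `centralDiv_plain_le` (`≤ 3`).

HONEST LABEL: calculus for the plain variables; the sum over all variables, (E2) and (E1) are NOT here; ⟨24141⟩ and ⟨22884⟩ stay OPEN; the Yang–Mills mass gap is NOT proved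
by this; no summit is proved by a line.  THEOREMS ONLY (no `def`, no `sorry`).

References: [cite: arXiv220412737, §2 (2.4) (p. 10)]; [cite: CosteEtAl1985].
-/

set_option autoImplicit false

noncomputable section

open scoped Matrix BigOperators Quaternion Topology
open Literature.MathematicalPhysics.QuantumFieldTheory hiding SU2
open Literature.MathematicalPhysics.QuantumLattice
open Literature.MathematicalPhysics.QuantumFieldTheory.SUNBakryEmery (matTop)

namespace Summit.QuantumFields.YangMills.Theorems.VirialFluxGap.CentralField

open Summit.QuantumFields.YangMills.Theorems.FemtoTransferGap
open Summit.QuantumFields.YangMills.Theorems.VirialFluxGap.RingDeficit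
open Summit.QuantumFields.YangMills.Theorems.VirialFluxGap.FrameDerivative
open Summit.QuantumFields.YangMills.Theorems.VirialFluxGap.FrameHessian
open Summit.QuantumFields.YangMills.Theorems.VirialFluxGap.FixFrame

variable {L : ℕ} [NeZero L]

open scoped Matrix.Norms.Frobenius

attribute [local instance 2000] Literature.MathematicalPhysics.QuantumFieldTheory.SUNBakryEmery.matTop

/-- The plain-slot formula of the central direction at ALL coordinates: the radial profile `quatMatrix(0, Im readQuat M_{i,e})`. [cite: arXiv220412737, §2 (2.4) (p. 10)] -/
theorem centralDir_inl_plain (σ : Fin 3 → ℝ) (σ₄ : ℝ)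
    (M : (Fin (2 * L - 1 + 1) → Edge 3 L → Matrix (Fin 2) (Fin 2) ℂ) × (Site 3 L → Matrix (Fin 2) (Fin 2) ℂ))
    (i : Fin (2 * L - 1 + 1)) (e : Edge 3 L) (htree : ¬(i = 0 ∧ treeEdge e = true)) (hx : e.1 e.2 ≠ -1) :
    centralDir L σ σ₄ M (Sum.inl (i, e)) = quatMatrix ⟨0, (readQuat (M.1 i e)).imI, (readQuat (M.1 i e)).imJ, (readQuat (M.1 i e)).imK⟩ := by
  rw [centralDir, if_neg htree, if_neg hx]
  simp only [anchoredIm, star_one, one_mul]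
  rfl

/-- The `a`-th coordinate of the central direction at a plain variable of a ring history: twice the `(2−a)`-th imaginary part of the variable's quaternion. [folklore] -/
theorem centralCoord_plain_eq (σ : Fin 3 → ℝ) (σ₄ : ℝ) (Q : (Fin (2 * L - 1 + 1) → GaugeConfig 3 L SU2) × (Site 3 L → SU2))
    (i : Fin (2 * L - 1 + 1)) (e : Edge 3 L) (htree : ¬(i = 0 ∧ treeEdge e = true)) (hx : e.1 e.2 ≠ -1) :
    pauliCoord (centralDir L σ σ₄ (ringCoord L Q) (Sum.inl (i, e))) 0 = 2 * (su2Quat (Q.1 i e)).imK ∧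
    pauliCoord (centralDir L σ σ₄ (ringCoord L Q) (Sum.inl (i, e))) 1 = 2 * (su2Quat (Q.1 i e)).imJ ∧
    pauliCoord (centralDir L σ σ₄ (ringCoord L Q) (Sum.inl (i, e))) 2 = 2 * (su2Quat (Q.1 i e)).imI := by
  rw [centralDir_inl_plain σ σ₄ (ringCoord L Q) i e htree hx]
  exact pauliCoord_quatMatrix_im _ _ _

/-- ★ **The coordinates of the central direction along the own frame curve of a plain variable** (admissible direction `quatMatrix p`): derivatives
`2·Im_b(q·p)`, `b = 2, 1, 0`, `q = su2Quat P_{i,e}`. [cite: arXiv220412737, §2 (2.4) (p. 10)] -/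
theorem hasDerivAt_centralCoord_plain (σ : Fin 3 → ℝ) (σ₄ : ℝ) (P : (Fin (2 * L - 1 + 1) → GaugeConfig 3 L SU2) × (Site 3 L → SU2))
    (i : Fin (2 * L - 1 + 1)) (e : Edge 3 L) (htree : ¬(i = 0 ∧ treeEdge e = true)) (hx : e.1 e.2 ≠ -1)
    (p : ℍ) (hY : (quatMatrix p)ᴴ = -quatMatrix p) (hY0 : (quatMatrix p).trace = 0) :
    HasDerivAt (fun s => pauliCoord (centralDir L σ σ₄ (ringCoord L (P * sliceCurve i e hY hY0 s)) (Sum.inl (i, e))) 0) (2 * (su2Quat (P.1 i e) * p).imK) 0 ∧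
    HasDerivAt (fun s => pauliCoord (centralDir L σ σ₄ (ringCoord L (P * sliceCurve i e hY hY0 s)) (Sum.inl (i, e))) 1) (2 * (su2Quat (P.1 i e) * p).imJ) 0 ∧
    HasDerivAt (fun s => pauliCoord (centralDir L σ σ₄ (ringCoord L (P * sliceCurve i e hY hY0 s)) (Sum.inl (i, e))) 2) (2 * (su2Quat (P.1 i e) * p).imI) 0 := by
  have hγ0 : P * sliceCurve i e hY hY0 0 = P := by rw [sliceCurve_zero, mul_one]
  have hq := hasDerivAt_sliceQuat_sliceCurve (L := L) i e p hY hY0 P 0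
  rw [hγ0] at hq
  obtain ⟨-, h₁, h₂, h₃⟩ := hasDerivAt_quatComponents hq
  refine ⟨?_, ?_, ?_⟩
  · have h := h₃.const_mul 2
    refine h.congr_of_eventuallyEq (Filter.Eventually.of_forall fun s => ?_)
    exact (centralCoord_plain_eq σ σ₄ _ i e htree hx).1
  · have h := h₂.const_mul 2
    refine h.congr_of_eventuallyEq (Filter.Eventually.of_forall fun s => ?_)
    exact (centralCoord_plain_eq σ σ₄ _ i e htree hx).2.1
  · have h := h₁.const_mul 2
    refine h.congr_of_eventuallyEq (Filter.Eventually.of_forall fun s => ?_)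
    exact (centralCoord_plain_eq σ σ₄ _ i e htree hx).2.2

/-- ★★ **The per-variable divergence of the explicit central field at a plain variable, as own-curve derivatives**: the three half-Pauli coordinates along the
own frame curves `P·sliceCurve_{(i,e), halfPauli a}` have derivatives `V₀, V₁, V₂` with `V₀ + V₁ + V₂ = 3·Re(su2Quat P_{i,e})`. [cite: arXiv220412737, §2 (2.4) (p. 10)] -/
theorem centralCoord_plain_trace (σ : Fin 3 → ℝ) (σ₄ : ℝ) (P : (Fin (2 * L - 1 + 1) → GaugeConfig 3 L SU2) × (Site 3 L → SU2))
    (i : Fin (2 * L - 1 + 1)) (e : Edge 3 L) (htree : ¬(i = 0 ∧ treeEdge e = true)) (hx : e.1 e.2 ≠ -1) :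
    ∃ V₀ V₁ V₂ : ℝ,
      HasDerivAt (fun s => pauliCoord (centralDir L σ σ₄ (ringCoord L (P * sliceCurve i e (halfPauli_conjTranspose 0) (halfPauli_trace 0) s)) (Sum.inl (i, e))) 0) V₀ 0 ∧
      HasDerivAt (fun s => pauliCoord (centralDir L σ σ₄ (ringCoord L (P * sliceCurve i e (halfPauli_conjTranspose 1) (halfPauli_trace 1) s)) (Sum.inl (i, e))) 1) V₁ 0 ∧
      HasDerivAt (fun s => pauliCoord (centralDir L σ σ₄ (ringCoord L (P * sliceCurve i e (halfPauli_conjTranspose 2) (halfPauli_trace 2) s)) (Sum.inl (i, e))) 2) V₂ 0 ∧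
      V₀ + V₁ + V₂ = 3 * (su2Quat (P.1 i e)).re := by
  obtain ⟨hY2, hY02⟩ := quatMatrix_half_zUnit 2
  obtain ⟨hY1, hY01⟩ := quatMatrix_half_zUnit 1
  obtain ⟨hY0, hY00⟩ := quatMatrix_half_zUnit 0
  obtain ⟨d0, -, -⟩ := hasDerivAt_centralCoord_plain σ σ₄ P i e htree hx ((1 / 2 : ℝ) • zUnit 2) hY2 hY02
  obtain ⟨-, d1, -⟩ := hasDerivAt_centralCoord_plain σ σ₄ P i e htree hx ((1 / 2 : ℝ) • zUnit 1) hY1 hY01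
  obtain ⟨-, -, d2⟩ := hasDerivAt_centralCoord_plain σ σ₄ P i e htree hx ((1 / 2 : ℝ) • zUnit 0) hY0 hY00
  obtain ⟨e0, e1, e2⟩ := halfPauli_eq_quatMatrix_half_zUnit
  rw [show (fun s => pauliCoord (centralDir L σ σ₄ (ringCoord L (P * sliceCurve i e hY2 hY02 s)) (Sum.inl (i, e))) 0) =
      fun s => pauliCoord (centralDir L σ σ₄ (ringCoord L (P * sliceCurve i e (halfPauli_conjTranspose 0) (halfPauli_trace 0) s)) (Sum.inl (i, e))) 0
      from funext fun s => by rw [sliceCurve_congr i e e0]] at d0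
  rw [show (fun s => pauliCoord (centralDir L σ σ₄ (ringCoord L (P * sliceCurve i e hY1 hY01 s)) (Sum.inl (i, e))) 1) =
      fun s => pauliCoord (centralDir L σ σ₄ (ringCoord L (P * sliceCurve i e (halfPauli_conjTranspose 1) (halfPauli_trace 1) s)) (Sum.inl (i, e))) 1
      from funext fun s => by rw [sliceCurve_congr i e e1]] at d1
  rw [show (fun s => pauliCoord (centralDir L σ σ₄ (ringCoord L (P * sliceCurve i e hY0 hY00 s)) (Sum.inl (i, e))) 2) =
      fun s => pauliCoord (centralDir L σ σ₄ (ringCoord L (P * sliceCurve i e (halfPauli_conjTranspose 2) (halfPauli_trace 2) s)) (Sum.inl (i, e))) 2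
      from funext fun s => by rw [sliceCurve_congr i e e2]] at d2
  refine ⟨_, _, _, d0, d1, d2, ?_⟩
  have h := im_mul_units_sum (su2Quat (P.1 i e))
  simp only [Quaternion.imI_mul, Quaternion.imJ_mul, Quaternion.imK_mul, Quaternion.re_smul, Quaternion.imI_smul, Quaternion.imJ_smul, Quaternion.imK_smul,
    zUnit, Matrix.cons_val_zero, Matrix.cons_val_one, Matrix.head_cons, Matrix.cons_val_two, Matrix.tail_cons, smul_eq_mul, mul_zero, mul_one,
    add_zero, sub_zero] at h ⊢
  linarith

/-- ★★ **The per-variable divergence of the explicit central field at a plain variable, frame form**: under differentiability of the three coordinates,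
`Σ_a frameD (stdFrame ((i,e), a)) (coordinate a) (ringCoord P) = 3·Re(su2Quat P_{i,e})`. [cite: arXiv220412737, §2 (2.4) (p. 10)] -/
theorem centralDiv_plain_eq (σ : Fin 3 → ℝ) (σ₄ : ℝ) (P : (Fin (2 * L - 1 + 1) → GaugeConfig 3 L SU2) × (Site 3 L → SU2))
    (i : Fin (2 * L - 1 + 1)) (e : Edge 3 L) (htree : ¬(i = 0 ∧ treeEdge e = true)) (hx : e.1 e.2 ≠ -1)
    (hdiff : ∀ a : Fin 3, DifferentiableAt ℝ (fun M => pauliCoord (centralDir L σ σ₄ M (Sum.inl (i, e))) a) (ringCoord L P)) :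
    frameD (stdFrame (Sum.inl (i, e), 0)) (fun M => pauliCoord (centralDir L σ σ₄ M (Sum.inl (i, e))) 0) (ringCoord L P) +
      frameD (stdFrame (Sum.inl (i, e), 1)) (fun M => pauliCoord (centralDir L σ σ₄ M (Sum.inl (i, e))) 1) (ringCoord L P) +
      frameD (stdFrame (Sum.inl (i, e), 2)) (fun M => pauliCoord (centralDir L σ σ₄ M (Sum.inl (i, e))) 2) (ringCoord L P) =
    3 * (su2Quat (P.1 i e)).re := by
  obtain ⟨V₀, V₁, V₂, h0, h1, h2, hsum⟩ := centralCoord_plain_trace σ σ₄ P i e htree hx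
  rw [frameD_stdFrame_eq_of_hasDerivAt i e 0 P (hdiff 0) h0, frameD_stdFrame_eq_of_hasDerivAt i e 1 P (hdiff 1) h1,
    frameD_stdFrame_eq_of_hasDerivAt i e 2 P (hdiff 2) h2]
  exact hsum

/-- ★ … hence at most `3`. [folklore] -/
theorem centralDiv_plain_le (σ : Fin 3 → ℝ) (σ₄ : ℝ) (P : (Fin (2 * L - 1 + 1) → GaugeConfig 3 L SU2) × (Site 3 L → SU2))
    (i : Fin (2 * L - 1 + 1)) (e : Edge 3 L) (htree : ¬(i = 0 ∧ treeEdge e = true)) (hx : e.1 e.2 ≠ -1)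
    (hdiff : ∀ a : Fin 3, DifferentiableAt ℝ (fun M => pauliCoord (centralDir L σ σ₄ M (Sum.inl (i, e))) a) (ringCoord L P)) :
    frameD (stdFrame (Sum.inl (i, e), 0)) (fun M => pauliCoord (centralDir L σ σ₄ M (Sum.inl (i, e))) 0) (ringCoord L P) +
      frameD (stdFrame (Sum.inl (i, e), 1)) (fun M => pauliCoord (centralDir L σ σ₄ M (Sum.inl (i, e))) 1) (ringCoord L P) +
      frameD (stdFrame (Sum.inl (i, e), 2)) (fun M => pauliCoord (centralDir L σ σ₄ M (Sum.inl (i, e))) 2) (ringCoord L P) ≤ 3 := by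
  rw [centralDiv_plain_eq σ σ₄ P i e htree hx hdiff]
  have h := abs_re_su2Quat_le (P.1 i e)
  have h' := (abs_le.1 h).2
  linarith

end Summit.QuantumFields.YangMills.Theorems.VirialFluxGap.CentralField

end
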